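import Mathlib
import Summits.Ventures.PercRepro2.TypedMarkedSeriesDefs
import Summits.Ventures.PercRepro2.TypedMarkedSeriesGraph
import Summits.Ventures.PercRepro2.TypedMarkedSeriesStateA
import Summits.Ventures.PercRepro2.TypedMarkedSeries
import Summits.Ventures.PercRepro2.TypedMarkedSeriesB13
import Summits.Ventures.PercRepro2.TypedMarkedSeriesIdF1
import Summits.Ventures.PercRepro2.TypedMarkedSeriesIdF2
import Summits.Ventures.PercRepro2.TypedMarkedSeriesIdFp1
import Summits.Ventures.PercRepro2.TypedMarkedSeriesIdFp2
import Summits.Ventures.PercRepro2.TypedSwapRoots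
import Summits.Ventures.PercRepro2.TypedPositiveOB

/-!
# Marked-series POSITIVITY rules: `o` of degree two between a root and `b`, and `b` of degree two
between a root and `o` (blind cell PercRepro2, night-3 g14, 2026-08-27; `proofs/NIGHT3-CERT.md` §23.8)

The marked-series method of `TypedMarkedSeries.lean` with an INEQUALITY in place of the identity:
if the nine-term colouring sum of the model is nonnegative on every consistent signature triple, the
typed base is nonnegative (`typedCount_nonneg_of_model`).  Of the degree-2 attachments of a mark to
two other marks, exactly three are of this kind (night-3 g14, kit j268129: the sums over the 3,375
consistent signature triples have no negative value and 498–522 positive ones for each type pair):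

* rule F — `o` between `a₁` and `b` (`typedCount_nonneg_of_o_between_a1_b`; mirror at `a₂`):
  model A for the marks with `b ↔ a₃` exchanged, through the coordinate swap (`st_swap_b3`);
* rule F′ — `b` between `a₁` and `o` (`typedCount_nonneg_of_b_between_a1_o`; mirror): rule F for the
  marking with `o ↔ b` exchanged, through `st_swap_ob`;
* (`o` between `a₃` and `b`: the same sign census, not filed — its state lemma is not a swap of
  model A).

Every other degree-2 attachment to two marks is either a vanishing rule (`TypedMarkedSeries.lean`,
`TypedMarkedSeriesB13.lean` under isolation) or INDEFINITE at the signature level (negative block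
sums exist, e.g. `a₃` between `a₁` and `o`: 354 / 3,375 at types (1, 1)); every attachment with an
unmarked neighbour is indefinite.  Nothing here asserts anything about the original lane.
-/

namespace Summit.Ventures.PercRepro2

open UnionCluster

namespace CovForm

namespace MarkedSeries

open OneTyped TypedA3 Untouched TypedRed

section Assembly

open Classical

variable {V : Type*} {E : Type*} [Fintype E] [DecidableEq E] {R : Type*} [Field R]
  [LinearOrder R] [IsStrictOrderedRing R]
variable (ends : E → Sym2 V) (o a₁ a₂ a₃ b : V)

/-- **The generic marked-series POSITIVITY theorem**: as `typedCount_eq_zero_of_model`, with the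
nine-term colouring sum of the model NONNEGATIVE on every consistent signature triple (`hid`); then
the typed base is nonnegative. -/
theorem typedCount_nonneg_of_model (F : Finset E) (z : Config E) (τ : E → ℕ)
    (hτ : ∀ e ∈ F, τ e = 1 ∨ τ e = 2) {e f : E} (hef : e ≠ f) (heF : e ∈ F) (hfF : f ∈ F)
    (md : Bool → Bool → Bool → Bool → Bool → Bool → Bool → Bool → St)
    (s1 s2 s3 s4 s5 s6 : Config E → Bool)
    (hcons : ∀ x, consB (s1 x) (s2 x) (s3 x) (s4 x) (s5 x) (s6 x) = true)
    (hst : ∀ x : Config E, (∀ e', e' ∉ (F.erase f).erase e →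
        x e' = Function.update (Function.update z f false) e false e') → ∀ p a : Bool,
      st ends o a₁ a₂ a₃ b (Function.update (Function.update x e p) f a) =
        md (s1 x) (s2 x) (s3 x) (s4 x) (s5 x) (s6 x) p a)
    (hid : ∀ k l : ℕ, (k = 1 ∨ k = 2) → (l = 1 ∨ l = 2) →
      ∀ c1 c2 c3 c4 c5 c6 : Bool, consB c1 c2 c3 c4 c5 c6 = true →
      ∀ d1 d2 d3 d4 d5 d6 : Bool, consB d1 d2 d3 d4 d5 d6 = true →
      ∀ e1 e2 e3 e4 e5 e6 : Bool, consB e1 e2 e3 e4 e5 e6 = true →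
      0 ≤ S9 k l (md c1 c2 c3 c4 c5 c6) (md d1 d2 d3 d4 d5 d6) (md e1 e2 e3 e4 e5 e6)) :
    0 ≤ typedCount F z τ (K3 ends o a₁ a₂ a₃ b : Config E → Config E → Config E → R) := by
  have h6 := six_mul_typedCount_KBsym (R := R) ends o a₁ a₂ a₃ b F z τ hτ
  have heF' : e ∈ F.erase f := Finset.mem_erase.2 ⟨hef, heF⟩
  have hk := hτ e heF
  have hl := hτ f hfF
  have hsplit : typedCount F z τ (fun x y w => ((KBsym (st ends o a₁ a₂ a₃ b x)
      (st ends o a₁ a₂ a₃ b y) (st ends o a₁ a₂ a₃ b w) : ℤ) : R)) =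
      ∑ a : Bool, ∑ b' : Bool, ∑ c : Bool, if a.toNat + b'.toNat + c.toNat = τ f then
        (∑ p : Bool, ∑ q : Bool, ∑ r : Bool, if p.toNat + q.toNat + r.toNat = τ e then
          typedCount ((F.erase f).erase e) (Function.update (Function.update z f false) e false) τ
            (fun x y w => ((KBsym (md (s1 x) (s2 x) (s3 x) (s4 x) (s5 x) (s6 x) p a)
              (md (s1 y) (s2 y) (s3 y) (s4 y) (s5 y) (s6 y) q b')
              (md (s1 w) (s2 w) (s3 w) (s4 w) (s5 w) (s6 w) r c) : ℤ) : R)) else 0) else 0 := by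
    rw [typedCount_split F f hfF]
    refine Finset.sum_congr rfl fun a _ => Finset.sum_congr rfl fun b' _ =>
      Finset.sum_congr rfl fun c _ => ?_
    refine if_congr Iff.rfl ?_ rfl
    rw [typedCount_split (F.erase f) e heF']
    refine Finset.sum_congr rfl fun p _ => Finset.sum_congr rfl fun q _ =>
      Finset.sum_congr rfl fun r _ => ?_
    refine if_congr Iff.rfl ?_ rfl
    refine typedCount_congr_on_support _ _ _ fun x y w hxyw _ => ?_
    rw [hst x (fun e' he' => (hxyw e' he').1) p a, hst y (fun e' he' => (hxyw e' he').2.1) q b',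
      hst w (fun e' he' => (hxyw e' he').2.2) r c]
  have hin : (∑ a : Bool, ∑ b' : Bool, ∑ c : Bool, if a.toNat + b'.toNat + c.toNat = τ f then
        (∑ p : Bool, ∑ q : Bool, ∑ r : Bool, if p.toNat + q.toNat + r.toNat = τ e then
          typedCount ((F.erase f).erase e) (Function.update (Function.update z f false) e false) τ
            (fun x y w => ((KBsym (md (s1 x) (s2 x) (s3 x) (s4 x) (s5 x) (s6 x) p a)
              (md (s1 y) (s2 y) (s3 y) (s4 y) (s5 y) (s6 y) q b')
              (md (s1 w) (s2 w) (s3 w) (s4 w) (s5 w) (s6 w) r c) : ℤ) : R)) else 0) else 0) =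
      typedCount ((F.erase f).erase e) (Function.update (Function.update z f false) e false) τ
        (fun x y w => ∑ a : Bool, ∑ b' : Bool, ∑ c : Bool,
          if a.toNat + b'.toNat + c.toNat = τ f then
            (∑ p : Bool, ∑ q : Bool, ∑ r : Bool, if p.toNat + q.toNat + r.toNat = τ e then
              ((KBsym (md (s1 x) (s2 x) (s3 x) (s4 x) (s5 x) (s6 x) p a)
                (md (s1 y) (s2 y) (s3 y) (s4 y) (s5 y) (s6 y) q b')
                (md (s1 w) (s2 w) (s3 w) (s4 w) (s5 w) (s6 w) r c) : ℤ) : R) else 0) else 0) := by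
    simp only [typedCount_sum_ite, typedCount_sum]
  have hnn : 0 ≤ typedCount ((F.erase f).erase e) (Function.update (Function.update z f false) e false) τ
        (fun x y w => ∑ a : Bool, ∑ b' : Bool, ∑ c : Bool,
          if a.toNat + b'.toNat + c.toNat = τ f then
            (∑ p : Bool, ∑ q : Bool, ∑ r : Bool, if p.toNat + q.toNat + r.toNat = τ e then
              ((KBsym (md (s1 x) (s2 x) (s3 x) (s4 x) (s5 x) (s6 x) p a)
                (md (s1 y) (s2 y) (s3 y) (s4 y) (s5 y) (s6 y) q b')
                (md (s1 w) (s2 w) (s3 w) (s4 w) (s5 w) (s6 w) r c) : ℤ) : R) else 0) else 0) := by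
    refine PositiveOB.typedCount_nonneg_of_nonneg_on_support _ _ _ fun x y w _ _ => ?_
    rw [sum_split_eq_S9 (τ e) (τ f) hk hl]
    exact_mod_cast hid (τ e) (τ f) hk hl _ _ _ _ _ _ (hcons x) _ _ _ _ _ _ (hcons y)
      _ _ _ _ _ _ (hcons w)
  rw [hsplit, hin] at h6
  rw [← h6] at hnn
  exact (mul_nonneg_iff_of_pos_left (by norm_num : (0 : R) < 6)).1 hnn

end Assembly

section Rules

open Classical

variable {V : Type*} {E : Type*} [Fintype E] [DecidableEq E] {R : Type*} [Field R]
  [LinearOrder R] [IsStrictOrderedRing R]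
variable (ends : E → Sym2 V) (o a₁ a₂ a₃ b : V)

omit [Fintype E] [DecidableEq E] in
/-- The state for the marks `(a₃, b)` is the state for the marks `(b, a₃)` with the `b`- and
`a₃`-coordinates exchanged. -/
lemma st_swap_b3 (x : Config E) :
    st ends o a₁ a₂ a₃ b x =
      ((st ends o a₁ a₂ b a₃ x).1, (st ends o a₁ a₂ b a₃ x).2.1, (st ends o a₁ a₂ b a₃ x).2.2.1,
        (st ends o a₁ a₂ b a₃ x).2.2.2.2.2.1, (st ends o a₁ a₂ b a₃ x).2.2.2.2.2.2,
        (st ends o a₁ a₂ b a₃ x).2.2.2.1, (st ends o a₁ a₂ b a₃ x).2.2.2.2.1) := by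
  unfold st
  rfl

/-- **Rule F: `o` between `a₁` and `b` — every typed base is nonnegative.**  If `o` carries exactly
the typed edges `e = {a₁, o}`, `f = {o, b}` (every other edge at `o` pinned closed and untyped), the
typed base is nonnegative. -/
theorem typedCount_nonneg_of_o_between_a1_b {e f : E} (hef : e ≠ f) (he : ends e = s(a₁, o))
    (hf : ends f = s(o, b)) (ho1 : o ≠ a₁) (ho2 : o ≠ a₂) (ho3 : o ≠ a₃) (hob : o ≠ b)
    (F : Finset E) (heF : e ∈ F) (hfF : f ∈ F) (z : Config E) (τ : E → ℕ)
    (hτ : ∀ e ∈ F, τ e = 1 ∨ τ e = 2)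
    (hcl : ∀ e', e' ≠ e → e' ≠ f → o ∈ ends e' → e' ∉ F ∧ z e' = false) :
    0 ≤ typedCount F z τ (K3 ends o a₁ a₂ a₃ b : Config E → Config E → Config E → R) := by
  refine typedCount_nonneg_of_model ends o a₁ a₂ a₃ b F z τ hτ hef heF hfF
    (fun c12 c13 c1b c23 c2b c3b p a => ((modelA c12 c13 c1b c23 c2b c3b p a).1, (modelA c12 c13 c1b c23 c2b c3b p a).2.1, (modelA c12 c13 c1b c23 c2b c3b p a).2.2.1, (modelA c12 c13 c1b c23 c2b c3b p a).2.2.2.2.2.1, (modelA c12 c13 c1b c23 c2b c3b p a).2.2.2.2.2.2, (modelA c12 c13 c1b c23 c2b c3b p a).2.2.2.1, (modelA c12 c13 c1b c23 c2b c3b p a).2.2.2.2.1))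
    (fun x => decide (Conn ends (Function.update (Function.update x e false) f false) a₁ a₂))
    (fun x => decide (Conn ends (Function.update (Function.update x e false) f false) a₁ a₃))
    (fun x => decide (Conn ends (Function.update (Function.update x e false) f false) a₁ b))
    (fun x => decide (Conn ends (Function.update (Function.update x e false) f false) a₂ a₃))
    (fun x => decide (Conn ends (Function.update (Function.update x e false) f false) a₂ b))
    (fun x => decide (Conn ends (Function.update (Function.update x e false) f false) a₃ b))
    (fun x => consB_sig ends _ a₁ a₂ a₃ b) (fun x hx p a => ?_) ?_
  · rw [st_swap_b3 ends o a₁ a₂ a₃ b,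
      st_modelA ends o a₁ a₂ b a₃ hef he hf ho1 ho2 hob ho3 x (closed_on_support2 F z hcl x hx) p a]
  · intro k l hk hl
    rcases hk with rfl | rfl <;> rcases hl with rfl | rfl
    · exact identF_11
    · exact identF_12
    · exact identF_21
    · exact identF_22

/-- **Rule F′: `b` between `a₁` and `o` — every typed base is nonnegative.** -/
theorem typedCount_nonneg_of_b_between_a1_o {e f : E} (hef : e ≠ f) (he : ends e = s(a₁, b))
    (hf : ends f = s(b, o)) (hb1 : b ≠ a₁) (hb2 : b ≠ a₂) (hb3 : b ≠ a₃) (hbo : b ≠ o)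
    (F : Finset E) (heF : e ∈ F) (hfF : f ∈ F) (z : Config E) (τ : E → ℕ)
    (hτ : ∀ e ∈ F, τ e = 1 ∨ τ e = 2)
    (hcl : ∀ e', e' ≠ e → e' ≠ f → b ∈ ends e' → e' ∉ F ∧ z e' = false) :
    0 ≤ typedCount F z τ (K3 ends o a₁ a₂ a₃ b : Config E → Config E → Config E → R) := by
  refine typedCount_nonneg_of_model ends o a₁ a₂ a₃ b F z τ hτ hef heF hfF
    (fun c12 c13 c1o c23 c2o c3o p a => ((modelA c12 c13 c1o c23 c2o c3o p a).1, (modelA c12 c13 c1o c23 c2o c3o p a).2.2.2.2.2.1, (modelA c12 c13 c1o c23 c2o c3o p a).2.2.2.2.2.2, (modelA c12 c13 c1o c23 c2o c3o p a).2.1, (modelA c12 c13 c1o c23 c2o c3o p a).2.2.1, (modelA c12 c13 c1o c23 c2o c3o p a).2.2.2.1, (modelA c12 c13 c1o c23 c2o c3o p a).2.2.2.2.1))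
    (fun x => decide (Conn ends (Function.update (Function.update x e false) f false) a₁ a₂))
    (fun x => decide (Conn ends (Function.update (Function.update x e false) f false) a₁ a₃))
    (fun x => decide (Conn ends (Function.update (Function.update x e false) f false) a₁ o))
    (fun x => decide (Conn ends (Function.update (Function.update x e false) f false) a₂ a₃))
    (fun x => decide (Conn ends (Function.update (Function.update x e false) f false) a₂ o))
    (fun x => decide (Conn ends (Function.update (Function.update x e false) f false) a₃ o))
    (fun x => consB_sig ends _ a₁ a₂ a₃ o) (fun x hx p a => ?_) ?_
  · rw [st_swap_ob ends o a₁ a₂ a₃ b, st_swap_b3 ends b a₁ a₂ a₃ o,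
      st_modelA ends b a₁ a₂ o a₃ hef he hf hb1 hb2 hbo hb3 x (closed_on_support2 F z hcl x hx) p a]
  · intro k l hk hl
    rcases hk with rfl | rfl <;> rcases hl with rfl | rfl
    · exact identFp_11
    · exact identFp_12
    · exact identFp_21
    · exact identFp_22

/-- The mirror of rule F: `o` between `a₂` and `b`. -/
theorem typedCount_nonneg_of_o_between_a2_b {e f : E} (hef : e ≠ f) (he : ends e = s(a₂, o))
    (hf : ends f = s(o, b)) (ho1 : o ≠ a₁) (ho2 : o ≠ a₂) (ho3 : o ≠ a₃) (hob : o ≠ b)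
    (F : Finset E) (heF : e ∈ F) (hfF : f ∈ F) (z : Config E) (τ : E → ℕ)
    (hτ : ∀ e ∈ F, τ e = 1 ∨ τ e = 2)
    (hcl : ∀ e', e' ≠ e → e' ≠ f → o ∈ ends e' → e' ∉ F ∧ z e' = false) :
    0 ≤ typedCount F z τ (K3 ends o a₁ a₂ a₃ b : Config E → Config E → Config E → R) := by
  rw [← SwapRoots.typedCount_swap_roots ends o a₁ a₂ a₃ b F z τ]
  exact typedCount_nonneg_of_o_between_a1_b ends o a₂ a₁ a₃ b hef he hf ho2 ho1 ho3 hob F heF hfF z τ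
    hτ hcl

/-- The mirror of rule F′: `b` between `a₂` and `o`. -/
theorem typedCount_nonneg_of_b_between_a2_o {e f : E} (hef : e ≠ f) (he : ends e = s(a₂, b))
    (hf : ends f = s(b, o)) (hb1 : b ≠ a₁) (hb2 : b ≠ a₂) (hb3 : b ≠ a₃) (hbo : b ≠ o)
    (F : Finset E) (heF : e ∈ F) (hfF : f ∈ F) (z : Config E) (τ : E → ℕ)
    (hτ : ∀ e ∈ F, τ e = 1 ∨ τ e = 2)
    (hcl : ∀ e', e' ≠ e → e' ≠ f → b ∈ ends e' → e' ∉ F ∧ z e' = false) :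
    0 ≤ typedCount F z τ (K3 ends o a₁ a₂ a₃ b : Config E → Config E → Config E → R) := by
  rw [← SwapRoots.typedCount_swap_roots ends o a₁ a₂ a₃ b F z τ]
  exact typedCount_nonneg_of_b_between_a1_o ends o a₂ a₁ a₃ b hef he hf hb2 hb1 hb3 hbo F heF hfF z τ
    hτ hcl

end Rules

end MarkedSeries

end CovForm

end Summit.Ventures.PercRepro2
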